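import Summits.QuantumFields.YangMills.Theorems.DirichletWindowAxialLogConvexityTorus
import Literature.MathematicalPhysics.QuantumLattice.LatticeGaugeDLR
import Literature.MathematicalPhysics.QuantumLattice.ContinuumLimitLGT

/-!
# `AxialLogConvexity` (item `stmt-QuantumFields-8940`, routes `DirichletWindow` /
# `XiCompleteMonotonicity` of `YangMills`) — II: all parities, and the limit

Helper file (supports `stmt-QuantumFields-8940`), continuing
`DirichletWindowAxialLogConvexityTorus` (same conventions: temporal plane `q`, axial sites
`Pi.single 0 c`, axial covariance `A` characterised by `hA`; no definition is introduced).

* **The torus inequalities for all parities** (`β ≥ 0`): `0 ≤ A_M(n)` for `1 ≤ n`, `n + 3 ≤ M`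
  (`tcov_natCast_nonneg`) and `A_M(n+2)² ≤ A_M(n+1) A_M(n+3)` for `n + 6 ≤ M`
  (`tcov_natCast_logConvex`): parity split of `M` and `n` over the three reflection-positive
  cones — link reflections control even separations, site reflections odd ones; on the odd torus
  the single reflection serves both, through the plaquettes next to either fixed hyperplane
  (`2(m - k) ≡ -(2k+1) mod 2m+1` and `A_M(-c) = A_M(c)`).
* **Passage to the limit** (`tendsto_tcov`), for the `(0,1)` plane: along the defining
  subsequence of tori of a limit point `μ` (`IsInfiniteVolumeLimitAlong`),
  `A_{L_k+1}(n) → f_β(n e₀) = plaquetteCorrFn ρ μ (n e₀)` (the bounded continuous cylinder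
  observables `P_0 P_n`, `P_0`, `P_n`; the torus restriction of the `ℤ⁴` plaquette observable is
  the torus plaquette observable, `toTorusObservable_plaquetteObs`); and `f_β(0) ≤ N²`
  (`plaquetteCorrFn_zero_le`).

References: K. Osterwalder, E. Seiler, Ann. Phys. 110 (1978) 440, §2; E. Seiler, LNP 159 (1982)
Ch. 2; J. Fröhlich, R. Israel, E. Lieb, B. Simon, Comm. Math. Phys. 62 (1978) 1, Thm. 2.1;
S. Chatterjee, arXiv:1803.01950, Problem 5.1.
-/

noncomputable section

open MeasureTheory ProbabilityTheory Filter Topology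
open Literature.MathematicalPhysics.QuantumFieldTheory

namespace Summit.QuantumFields.YangMills.Theorems

namespace AxialLogConvexity

variable {G : Type*} [Group G] [TopologicalSpace G] [IsTopologicalGroup G] [CompactSpace G]
  [MeasurableSpace G] [BorelSpace G] {N : ℕ} (ρ : G →* Matrix (Fin N) (Fin N) ℂ)

/-! ### The torus inequalities for all parities -/

section Parity

variable {M : ℕ} {q : {p : Fin 4 × Fin 4 // p.1 < p.2}} [NeZero M] {β : ℝ} {A : ZMod M → ℝ}
  (hA : ∀ c : ZMod M, A c = cov[fun U => WilsonRP.plaqRe ρ U ((Pi.single 0 0 : Site 4 M), q),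
    fun U => WilsonRP.plaqRe ρ U ((Pi.single 0 c : Site 4 M), q); wilsonMeasure (d := 4) (L := M) ρ β])
include hA

/-- **Positivity of the torus axial covariances**: `0 ≤ A_M(n)` for `1 ≤ n`, `n + 3 ≤ M`,
`β ≥ 0` (parity split of `M` and `n` over the three reflection-positive cones). [folklore] -/
theorem tcov_natCast_nonneg (hq : q.1.1 = 0) (hρ : Continuous ρ) (hβ : 0 ≤ β) {n : ℕ} (hn1 : 1 ≤ n)
    (hn : n + 3 ≤ M) : 0 ≤ A ((n : ℕ) : ZMod M) := by
  rcases Nat.even_or_odd M with hM | hM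
  · have hE := Nat.even_iff.mp hM
    rcases Nat.even_or_odd n with ⟨k, hk⟩ | ⟨k, hk⟩
    · have h := (tcov_link_even ρ hA hq hM hρ hβ (s := k) (t := k) (by omega) (by omega) (by omega)
        (by omega)).1
      rwa [show 2 * k = n by omega] at h
    · have h := (tcov_site_even ρ hA hq hM hρ (s := k) (t := k) (by omega) (by omega)).1
      rwa [show 2 * k + 1 = n by omega] at h
  · obtain ⟨m, hm⟩ := hM
    have hO : Odd M := ⟨m, hm⟩
    rcases Nat.even_or_odd n with ⟨k, hk⟩ | ⟨k, hk⟩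
    · have h := (tcov_odd ρ hA hq hO (by omega) hρ hβ (a := k) (b := k) (by omega) (by omega)
        (by omega) (by omega)).1
      rwa [show 2 * k = n by omega] at h
    · -- the plaquette next to the site hyperplane: `a = m - k`, `2a ≡ -n`
      have h := (tcov_odd ρ hA hq hO (by omega) hρ hβ (a := m - k) (b := m - k) (by omega)
        (by omega) (by omega) (by omega)).1
      rwa [natCast_eq_neg_natCast (y := n) (by omega), tcov_neg ρ hA] at h

/-- **Log-convexity of the torus axial covariances**: `A_M(n+2)² ≤ A_M(n+1) A_M(n+3)` for
`n + 6 ≤ M`, `β ≥ 0`. [folklore] -/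
theorem tcov_natCast_logConvex (hq : q.1.1 = 0) (hρ : Continuous ρ) (hβ : 0 ≤ β) {n : ℕ}
    (hn : n + 6 ≤ M) :
    A ((n + 2 : ℕ) : ZMod M) ^ 2 ≤ A ((n + 1 : ℕ) : ZMod M) * A ((n + 3 : ℕ) : ZMod M) := by
  rcases Nat.even_or_odd M with hM | hM
  · have hE := Nat.even_iff.mp hM
    rcases Nat.even_or_odd n with ⟨k, hk⟩ | ⟨k, hk⟩
    · -- `n + 1`, `n + 3` odd: site reflection with `s = k`, `t = k + 1`
      have h := (tcov_site_even ρ hA hq hM hρ (s := k) (t := k + 1) (by omega) (by omega)).2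
      rwa [show 2 * k + 1 = n + 1 by omega, show 2 * (k + 1) + 1 = n + 3 by omega,
        show k + (k + 1) + 1 = n + 2 by omega] at h
    · -- `n + 1`, `n + 3` even: link reflection with `s = k + 1`, `t = k + 2`
      have h := (tcov_link_even ρ hA hq hM hρ hβ (s := k + 1) (t := k + 2) (by omega) (by omega)
        (by omega) (by omega)).2
      rwa [show 2 * (k + 1) = n + 1 by omega, show 2 * (k + 2) = n + 3 by omega,
        show k + 1 + (k + 2) = n + 2 by omega] at h
  · obtain ⟨m, hm⟩ := hM
    have hO : Odd M := ⟨m, hm⟩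
    rcases Nat.even_or_odd n with ⟨k, hk⟩ | ⟨k, hk⟩
    · -- `n + 1`, `n + 3` odd: plaquettes next to the site hyperplane, `a = m - k`, `b = m - k - 1`
      have h := (tcov_odd ρ hA hq hO (by omega) hρ hβ (a := m - k) (b := m - k - 1) (by omega)
        (by omega) (by omega) (by omega)).2
      rwa [natCast_eq_neg_natCast (x := 2 * (m - k)) (y := n + 1) (by omega),
        natCast_eq_neg_natCast (x := 2 * (m - k - 1)) (y := n + 3) (by omega),
        natCast_eq_neg_natCast (x := m - k + (m - k - 1)) (y := n + 2) (by omega),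
        tcov_neg ρ hA, tcov_neg ρ hA, tcov_neg ρ hA] at h
    · -- `n + 1`, `n + 3` even: plaquettes next to the link hyperplane, `a = k + 1`, `b = k + 2`
      have h := (tcov_odd ρ hA hq hO (by omega) hρ hβ (a := k + 1) (b := k + 2) (by omega) (by omega)
        (by omega) (by omega)).2
      rwa [show 2 * (k + 1) = n + 1 by omega, show 2 * (k + 2) = n + 3 by omega,
        show k + 1 + (k + 2) = n + 2 by omega] at h

end Parity

/-! ### Passage to infinite-volume limit points -/

section Limit

open Literature.MathematicalPhysics.QuantumLattice

omit [MeasurableSpace G] [BorelSpace G] in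
/-- Reduction mod `M` of a displaced site. [folklore] -/
theorem proj_add_single (M : ℕ) (y : Literature.Probability.LatticeModels.Site 4) (i : Fin 4) :
    Literature.Probability.LatticeModels.Torus.proj M (y + Pi.single i 1) =
      Site.shift (Literature.Probability.LatticeModels.Torus.proj M y) i := by
  funext k
  by_cases hk : k = i
  · subst hk; simp [Site.shift]
  · simp [Site.shift, hk]

omit [TopologicalSpace G] [IsTopologicalGroup G] [CompactSpace G] [MeasurableSpace G]
  [BorelSpace G] in
/-- Plaquette holonomies of the periodic lift are the torus plaquette holonomies. [folklore] -/
theorem plaquetteHolonomyZd_torusLift (M : ℕ) (U : GaugeConfig 4 M G)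
    (y : Literature.Probability.LatticeModels.Site 4) (i j : Fin 4) :
    plaquetteHolonomyZd (torusLift M U) y i j =
      plaquetteHolonomy U (Literature.Probability.LatticeModels.Torus.proj M y) i j := by
  simp only [plaquetteHolonomyZd, plaquetteHolonomy, torusLift, Function.comp_apply, torusEdge,
    proj_add_single]

omit [TopologicalSpace G] [IsTopologicalGroup G] [CompactSpace G] [MeasurableSpace G]
  [BorelSpace G] in
/-- The torus restriction of the `(0,1)` plaquette observable is the torus plaquette observable at
the projected base point. [folklore] -/
theorem toTorusObservable_plaquetteObs (M : ℕ) (y : Literature.Probability.LatticeModels.Site 4) :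
    toTorusObservable M (plaquetteObs (G := G) ρ y 0 1) = fun U =>
      WilsonRP.plaqRe ρ U (Literature.Probability.LatticeModels.Torus.proj M y, ⟨(0, 1), Fin.zero_lt_one⟩) := by
  funext U
  simp only [toTorusObservable_apply, plaquetteObs, WilsonRP.plaqRe, plaquetteHolonomyZd_torusLift]

/-- The projection of the axial site `n e₀` of `ℤ⁴` is the axial torus site `n e₀`. [folklore] -/
theorem proj_zsmul_single (M : ℕ) (n : ℕ) :
    Literature.Probability.LatticeModels.Torus.proj M ((n : ℤ) • Pi.single (0 : Fin 4) (1 : ℤ)) =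
      (Pi.single 0 (n : ZMod M) : Site 4 M) := by
  funext k
  by_cases hk : k = 0
  · subst hk; simp
  · simp [hk]

/-- The projection of the origin is the origin `= 0 e₀`. [folklore] -/
theorem proj_zero (M : ℕ) :
    Literature.Probability.LatticeModels.Torus.proj M (0 : Literature.Probability.LatticeModels.Site 4) =
      (Pi.single 0 (0 : ZMod M) : Site 4 M) := by
  funext k
  by_cases hk : k = 0
  · subst hk; simp
  · simp [hk]

omit [MeasurableSpace G] [BorelSpace G] in
/-- `|Re tr ρ(U_p)| ≤ N` for a continuous representation (unitarian trick). [folklore] -/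
theorem abs_plaquetteObs_le' (hρ : Continuous ρ) (y : Literature.Probability.LatticeModels.Site 4)
    (U : LGConfig 4 G) : |plaquetteObs ρ y 0 1 U| ≤ N := by
  show |(ρ (plaquetteHolonomyZd U y 0 1)).trace.re| ≤ (N : ℝ)
  have h := Literature.RepresentationTheory.CompactGroups.CompactGroup.abs_re_trace_le_card ρ hρ
    (plaquetteHolonomyZd U y 0 1)
  rwa [Fintype.card_fin] at h

omit [TopologicalSpace G] [IsTopologicalGroup G] [CompactSpace G] [MeasurableSpace G]
  [BorelSpace G] in
/-- The `(0,1)` plaquette observable at `y` is a cylinder observable. [folklore] -/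
theorem isCylinder_plaquetteObs' (y : Literature.Probability.LatticeModels.Site 4) :
    IsCylinder (plaquetteObs (G := G) ρ y 0 1) (plaquetteEdges (y, ⟨(0, 1), Fin.zero_lt_one⟩)) :=
  isCylinder_plaquetteObs ρ (y, ⟨(0, 1), Fin.zero_lt_one⟩)

/-- **The torus axial covariances converge to the axial covariance of the limit point**:
`A_{L_k+1}(n) → f_β(n e₀)` along the defining subsequence of tori. [folklore] -/
theorem tendsto_tcov (hρ : Continuous ρ) {β : ℝ} {μ : Measure (LGConfig 4 G)} {Ls : ℕ → ℕ}
    (hlim : IsInfiniteVolumeLimitAlong (d := 4) ρ β Ls μ) (n : ℕ) :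
    Tendsto (fun k : ℕ =>
      cov[fun U => WilsonRP.plaqRe ρ U ((Pi.single 0 0 : Site 4 (Ls k + 1)), ⟨(0, 1), Fin.zero_lt_one⟩),
        fun U => WilsonRP.plaqRe ρ U ((Pi.single 0 ((n : ℕ) : ZMod (Ls k + 1)) : Site 4 (Ls k + 1)),
          ⟨(0, 1), Fin.zero_lt_one⟩); wilsonMeasure (d := 4) (L := Ls k + 1) ρ β]) atTop
      (𝓝 (plaquetteCorrFn ρ μ ((n : ℤ) • Pi.single (0 : Fin 4) (1 : ℤ)))) := by
  set x : Literature.Probability.LatticeModels.Site 4 := (n : ℤ) • Pi.single (0 : Fin 4) (1 : ℤ) with hx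
  have hc0 := continuous_plaquetteObs (G := G) ρ hρ (0 : Literature.Probability.LatticeModels.Site 4) 0 1
  have hcx := continuous_plaquetteObs (G := G) ρ hρ x 0 1
  have hb0 : ∃ C, ∀ U : LGConfig 4 G,
      |plaquetteObs ρ (0 : Literature.Probability.LatticeModels.Site 4) 0 1 U| ≤ C :=
    ⟨N, abs_plaquetteObs_le' ρ hρ 0⟩
  have hbx : ∃ C, ∀ U : LGConfig 4 G, |plaquetteObs ρ x 0 1 U| ≤ C := ⟨N, abs_plaquetteObs_le' ρ hρ x⟩
  -- the three convergences
  have h0 := hlim.2 _ _ (isCylinder_plaquetteObs' ρ (0 : Literature.Probability.LatticeModels.Site 4)) hc0 hb0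
  have h1 := hlim.2 _ _ (isCylinder_plaquetteObs' ρ x) hcx hbx
  have h2 := hlim.2
    (fun U => plaquetteObs ρ (0 : Literature.Probability.LatticeModels.Site 4) 0 1 U * plaquetteObs ρ x 0 1 U)
    (plaquetteEdges ((0 : Literature.Probability.LatticeModels.Site 4), ⟨(0, 1), Fin.zero_lt_one⟩) ∪
      plaquetteEdges (x, ⟨(0, 1), Fin.zero_lt_one⟩))
    (fun U V hUV => by
      show plaquetteObs ρ 0 0 1 U * plaquetteObs ρ x 0 1 U = plaquetteObs ρ 0 0 1 V * plaquetteObs ρ x 0 1 V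
      rw [isCylinder_plaquetteObs' ρ (0 : Literature.Probability.LatticeModels.Site 4) fun e he => hUV e (by
          rw [Finset.coe_union]; exact Or.inl he),
        isCylinder_plaquetteObs' ρ x fun e he => hUV e (by
          rw [Finset.coe_union]; exact Or.inr he)])
    (hc0.mul hcx)
    ⟨N * N, fun U => by
      rw [abs_mul]
      exact mul_le_mul (abs_plaquetteObs_le' ρ hρ 0 U) (abs_plaquetteObs_le' ρ hρ x U) (abs_nonneg _)
        ((abs_nonneg _).trans (abs_plaquetteObs_le' ρ hρ 0 U))⟩
  have h := h2.sub (h0.mul h1)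
  refine h.congr fun k => ?_
  -- identify the torus quantities
  haveI := isProbabilityMeasure_wilsonMeasure (d := 4) (L := Ls k + 1) ρ hρ β
  have hT : toTorusObservable (Ls k + 1)
      (fun U => plaquetteObs ρ (0 : Literature.Probability.LatticeModels.Site 4) 0 1 U * plaquetteObs ρ x 0 1 U) =
      fun U : GaugeConfig 4 (Ls k + 1) G =>
        WilsonRP.plaqRe ρ U ((Pi.single 0 (0 : ZMod (Ls k + 1)) : Site 4 (Ls k + 1)), ⟨(0, 1), Fin.zero_lt_one⟩) *
          WilsonRP.plaqRe ρ U ((Pi.single 0 (n : ZMod (Ls k + 1)) : Site 4 (Ls k + 1)),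
            ⟨(0, 1), Fin.zero_lt_one⟩) := by
    funext U
    simp only [toTorusObservable_apply, hx, plaquetteObs, WilsonRP.plaqRe, plaquetteHolonomyZd_torusLift,
      proj_zero, proj_zsmul_single]
  rw [hT, toTorusObservable_plaquetteObs, toTorusObservable_plaquetteObs, proj_zero, hx,
    proj_zsmul_single]
  unfold wilsonExpectation
  rw [covariance_eq_sub (memLp_tplaq ρ hρ β _) (memLp_tplaq ρ hρ β _)]
  rfl

omit [BorelSpace G] in
/-- `f_β(0) ≤ N²` for every probability measure (`Var ≤ E[P₀²] ≤ N²`). [folklore] -/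
theorem plaquetteCorrFn_zero_le (hρ : Continuous ρ) (μ : Measure (LGConfig 4 G))
    [IsProbabilityMeasure μ] :
    plaquetteCorrFn ρ μ (0 : Literature.Probability.LatticeModels.Site 4) ≤ (N : ℝ) ^ 2 := by
  show (∫ U, plaquetteObs ρ (0 : Literature.Probability.LatticeModels.Site 4) 0 1 U *
      plaquetteObs ρ (0 : Literature.Probability.LatticeModels.Site 4) 0 1 U ∂μ) -
      (∫ U, plaquetteObs ρ (0 : Literature.Probability.LatticeModels.Site 4) 0 1 U ∂μ) *
        (∫ U, plaquetteObs ρ (0 : Literature.Probability.LatticeModels.Site 4) 0 1 U ∂μ) ≤ (N : ℝ) ^ 2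
  have hsq : 0 ≤ (∫ U, plaquetteObs ρ (0 : Literature.Probability.LatticeModels.Site 4) 0 1 U ∂μ) *
      (∫ U, plaquetteObs ρ (0 : Literature.Probability.LatticeModels.Site 4) 0 1 U ∂μ) :=
    mul_self_nonneg _
  have hbd : ∀ U, ‖plaquetteObs ρ (0 : Literature.Probability.LatticeModels.Site 4) 0 1 U *
      plaquetteObs ρ (0 : Literature.Probability.LatticeModels.Site 4) 0 1 U‖ ≤ (N : ℝ) ^ 2 :=
    fun U => by
      rw [Real.norm_eq_abs, abs_mul, sq]
      exact mul_le_mul (abs_plaquetteObs_le' ρ hρ 0 U) (abs_plaquetteObs_le' ρ hρ 0 U) (abs_nonneg _)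
        (Nat.cast_nonneg _)
  have hint : (∫ U, plaquetteObs ρ (0 : Literature.Probability.LatticeModels.Site 4) 0 1 U *
      plaquetteObs ρ (0 : Literature.Probability.LatticeModels.Site 4) 0 1 U ∂μ) ≤ (N : ℝ) ^ 2 :=
    calc _ ≤ ‖∫ U, plaquetteObs ρ (0 : Literature.Probability.LatticeModels.Site 4) 0 1 U *
          plaquetteObs ρ (0 : Literature.Probability.LatticeModels.Site 4) 0 1 U ∂μ‖ :=
          Real.le_norm_self _
      _ ≤ (N : ℝ) ^ 2 * μ.real Set.univ := norm_integral_le_of_norm_le_const (Eventually.of_forall hbd)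
      _ = (N : ℝ) ^ 2 := by rw [probReal_univ, mul_one]
  linarith

end Limit

end AxialLogConvexity

end Summit.QuantumFields.YangMills.Theorems

end
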